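import Mathlib
import Summits.Ventures.PercRepro2.HCov
import Summits.Ventures.PercRepro2.ContractDefs
import Summits.Ventures.PercRepro2.RECMReduction

/-!
# The a₃-edge contraction reduction of (HCOV) (blind cell PercRepro2, mine-2 g15;
MINE2-A3FIRST.md §2 — the weighted form of the a₃-FIRST induction)

The root-edge reduction `RECM.HCov_all_of_RECM_all` (p1) with `a₃` in place of the root `a₁`:

**(a₃-RECM) at an a₃-edge.** For an edge `e = {a₃, y}` whose other end `y` is UNMARKED, `G/e` is the
graph in which `y` is merged into `a₃` (`Contract.contractEnds ends {a₃, y} a₃`, exactly as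
`RECM.contractRootEdge` with `a₃` for `a₁`: `e` and its parallels become loops at `a₃`, `y` becomes
isolated). The local inequality is `A3RECMAt`: `p_e · Gc(G/e) ≤ Gc(G)` (row 2′A3-CW in its weighted
form; census 0 violations on 7,813 + 727,659 + 1,404,916 non-vacuous typed profiles, MINE2-A3FIRST §1).

**Class R₃** (`A3ToMarks`): every edge at `a₃` has both ends among the five marks. On this class
(HCOV) is the a₃-hub of MINE2-A3FIRST.md §3 (computer-assisted; here a hypothesis `HCovR3_all`).

**THE REDUCTION** (`HCov_all_of_A3RECM_all`): `A3RECM_all ∧ HCovR3_all → HCov_all`, by strong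
induction on the number of non-loop edges (`RECM.nonLoopCard`): if some a₃-edge reaches an unmarked
vertex, contract it — `Gc(G) ≥ p_e · Gc(G/e) ≥ 0` by (a₃-RECM) and the induction hypothesis
(`RECM.nonLoopCard_contract_lt` is generic in the vertex names); otherwise the graph is in class R₃.
No root symmetry and no contraction into a mark is ever needed. So a minimal counterexample to
(HCOV) has `a₃` adjacent only to marks.
-/

namespace Summit.Ventures.PercRepro2

open CovForm Contract RECM

namespace A3RECM

section Defs

variable {V : Type*} {E : Type*} [Fintype E] [DecidableEq E] [DecidableEq V] {R : Type*}
  [Field R] [LinearOrder R]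

/-- **(a₃-RECM) at the a₃-edge `e = {a₃, y}`**: `p_e · Gc(G/e) ≤ Gc(G)`, with `G/e` read as
`contractRootEdge ends a₃ y` (= `contractEnds ends {a₃, y} a₃`: `y` merged into `a₃`). -/
def A3RECMAt (p : E → R) (ends : E → Sym2 V) (o a₁ a₂ a₃ b : V) (e : E) (y : V) : Prop :=
  p e * Gc p (contractRootEdge ends a₃ y) o a₁ a₂ a₃ b ≤ Gc p ends o a₁ a₂ a₃ b

/-- **Class R₃** (MINE2-A3FIRST.md §2): every edge at `a₃` has both of its ends among the marks
(«`a₃` adjacent only to marked vertices»; loops at `a₃` qualify trivially). -/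
def A3ToMarks (ends : E → Sym2 V) (o a₁ a₂ a₃ b : V) : Prop :=
  ∀ e, a₃ ∈ ends e → ∀ z ∈ ends e, z = o ∨ z = a₁ ∨ z = a₂ ∨ z = a₃ ∨ z = b

end Defs

section Closure

variable (R : Type*) [Field R] [LinearOrder R] [IsStrictOrderedRing R]

/-- **Row 2′A3-CW (weighted form)**: (a₃-RECM) at every a₃-edge `e = {a₃, y}` with `y` unmarked, on
every finite graph with distinct marks and admissible weights. -/
def A3RECM_all : Prop :=
  ∀ (V E : Type) [Fintype V] [DecidableEq V] [Fintype E] [DecidableEq E]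
    (ends : E → Sym2 V) (p : E → R), IsProbVec p →
    ∀ o a₁ a₂ a₃ b : V, a₁ ≠ a₂ → a₁ ≠ a₃ → a₂ ≠ a₃ → o ≠ a₁ → o ≠ a₂ → o ≠ a₃ → o ≠ b →
      b ≠ a₁ → b ≠ a₂ → b ≠ a₃ → ∀ (y : V) (e : E), Unmarked o a₁ a₂ a₃ b y → ends e = s(a₃, y) →
        A3RECMAt p ends o a₁ a₂ a₃ b e y

/-- **(HCOV) on class R₃** (the a₃-hub of MINE2-A3FIRST.md §3, as a hypothesis): (HCOV) for every
finite graph with distinct marks and admissible weights in which every edge at `a₃` ends in a mark. -/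
def HCovR3_all : Prop :=
  ∀ (V E : Type) [Fintype V] [DecidableEq V] [Fintype E] [DecidableEq E]
    (ends : E → Sym2 V) (p : E → R), IsProbVec p →
    ∀ o a₁ a₂ a₃ b : V, a₁ ≠ a₂ → a₁ ≠ a₃ → a₂ ≠ a₃ → o ≠ a₁ → o ≠ a₂ → o ≠ a₃ → o ≠ b →
      b ≠ a₁ → b ≠ a₂ → b ≠ a₃ → A3ToMarks ends o a₁ a₂ a₃ b → HCov p ends o a₁ a₂ a₃ b

end Closure

section Main

variable {R : Type*} [Field R] [LinearOrder R] [IsStrictOrderedRing R]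

/-- **The reduction, by strong induction on the number of non-loop edges**: (HCOV) for every graph
on the types `V, E` from (a₃-RECM) at unmarked-`y` a₃-edges and (HCOV) on class R₃. -/
theorem HCov_of_A3RECM_of_base {V E : Type} [Fintype V] [DecidableEq V] [Fintype E] [DecidableEq E]
    (hR : A3RECM_all R) (hB : HCovR3_all R) (n : ℕ) :
    ∀ (ends : E → Sym2 V), nonLoopCard ends = n → ∀ (p : E → R), IsProbVec p →
      ∀ o a₁ a₂ a₃ b : V, a₁ ≠ a₂ → a₁ ≠ a₃ → a₂ ≠ a₃ → o ≠ a₁ → o ≠ a₂ → o ≠ a₃ → o ≠ b →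
        b ≠ a₁ → b ≠ a₂ → b ≠ a₃ → HCov p ends o a₁ a₂ a₃ b := by
  induction n using Nat.strong_induction_on with
  | _ n ih =>
  intro ends hn p hp o a₁ a₂ a₃ b h12 h13 h23 ho1 ho2 ho3 hob hb1 hb2 hb3
  by_cases h3 : ∃ (e : E) (y : V), Unmarked o a₁ a₂ a₃ b y ∧ ends e = s(a₃, y)
  · -- an a₃-edge reaches an unmarked vertex: contract it
    obtain ⟨e, y, hy, he⟩ := h3
    have hrecm := hR V E ends p hp o a₁ a₂ a₃ b h12 h13 h23 ho1 ho2 ho3 hob hb1 hb2 hb3 y e hy he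
    have hlt : nonLoopCard (contractRootEdge ends a₃ y) < n :=
      hn ▸ nonLoopCard_contract_lt ends hy.2.2.2.1.symm he
    have hIH := ih _ hlt (contractRootEdge ends a₃ y) rfl p hp o a₁ a₂ a₃ b h12 h13 h23 ho1 ho2
      ho3 hob hb1 hb2 hb3
    unfold HCov at hIH ⊢
    unfold A3RECMAt at hrecm
    exact le_trans (mul_nonneg (hp.nonneg e) hIH) hrecm
  · -- `a₃` is adjacent only to marks: class R₃
    apply hB V E ends p hp o a₁ a₂ a₃ b h12 h13 h23 ho1 ho2 ho3 hob hb1 hb2 hb3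
    intro f hf z hz
    obtain ⟨y, hy⟩ := Sym2.mem_iff_exists.mp hf
    rw [hy] at hz
    rcases Sym2.mem_iff.mp hz with hz1 | hz2
    · rw [hz1]
      simp
    · rw [hz2]
      by_contra hzm
      push Not at hzm
      exact h3 ⟨f, y, hzm, hy⟩

/-- **THE a₃-EDGE REDUCTION OF (HCOV)**: `A3RECM_all ∧ HCovR3_all → HCov_all` — (HCOV) for every
finite weighted graph follows from (a₃-RECM) at a₃-edges with an unmarked other end together with
(HCOV) on class R₃ (MINE2-A3FIRST.md §2, the weighted form). -/
theorem HCov_all_of_A3RECM_all (hR : A3RECM_all R) (hB : HCovR3_all R) : HCov_all R := by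
  intro V E _ _ _ _ ends p hp o a₁ a₂ a₃ b h12 h13 h23 ho1 ho2 ho3 hob hb1 hb2 hb3
  exact HCov_of_A3RECM_of_base hR hB _ ends rfl p hp o a₁ a₂ a₃ b h12 h13 h23 ho1 ho2 ho3 hob hb1
    hb2 hb3

end Main

end A3RECM

end Summit.Ventures.PercRepro2
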